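import Summits.BirchSwinnertonDyer.Rank1Residual.WAll.AltClosersCMTwoRamifiedGenusClass
import Summits.BirchSwinnertonDyer.BirchSwinnertonDyer.Theorems.PrintCf2RamifiedTYZFamilies
import Literature.NumberTheory.EllipticCurves.Tian2014.CMPointSystemGenusBridge
import HarnessLib

/-!
# Route `PrintCf2` (cell `bsd-print-cf2`), item stmt-BirchSwinnertonDyer-20362 `RamifiedTwoRankOneOfFacts` — file 2:
# the `ω = 3` FJ atlas INSIDE the bundle, the maximal flag-free p1 slice, and the U⁺ road under ONE extra fact

HONEST FRAMING (cell `bsd-print-cf2`, run/shared/lean/pub/bsd-print-cf2/): companion of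
`Theorems/PrintCf2RamifiedTYZFamilies.lean` (p539279); proofs only, no route file imported (bsd-wall T9), nothing
asserted — every fact is an antecedent. With Rédei–Reichardt and Monsky's odd `2`-Selmer count DISCHARGED in the
tree (`redeiReichardt_fourTwoCard_classGroup_holds`, `HeathBrown1994.monsky_card_selmerGroup_two_odd_holds`), the
`ω = 3` Faulkner–James atlas leaf `WAllCornerFTwoRamifiedTYZAtlasFJ` closes modulo {TYZ17 Thm 1.2′, GZK} ⊂ 𝔅_ram
(p538378), so the MAXIMAL FLAG-FREE p1 SLICE of crux 20362 is `CongruentTYZProvedFamily ∨ CongruentTYZAtlasFJFamily`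
(§1). The U⁺-road leaf `WAllCornerFTwoRamifiedTYZUPlus` (Tian 2014 class 6, the ρ-free TYZ genus class = Tian
ICM 2022 Thm 8 per `n`, the `ω = 3` atlas with `s(n) = 1` alone) needs exactly ONE fact outside 𝔅_ram, the ∃-display
`tyz_genusPointData` (A312, LITERAL per the cell referee): §2 states the `…OfFactsPlus`-shaped consequences —
𝔅_ram ∧ A312 ⟹ that leaf, and 𝔅_ram ∧ A312 ⟹ (crux 20362 ⟸ the four-way residual `WAllCornerFTwoRamifiedOffTYZ`).
Beyond print: FJ atlas YES (flag-free); U⁺ families YES but LITERAL.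

References: route file `Theses/PrintCf2.lean` (item 20362), HOME/PLAN.md v1 §2; `WAll/TargetCMTwoRamifiedFamilies.lean`
(p533515), `WAll/TargetCMTwoRamifiedOffTYZProved.lean` (p536500), `WAll/AltClosersCMTwoRamified{Families,GenusClass}.lean`
(p535702, p538378). [cite: TianYuanZhang2017, Thm. 1.2, §3] [cite: FaulknerJames2007, Thm. 1.2 (2)]
[cite: HeathBrown1994SelmerCongruentII, Appendix (Monsky)] [cite: Miller2011LMS, Def. 1.1].
-/

noncomputable section

open scoped Classical

open WeierstrassCurve Literature.NumberTheory.EllipticCurves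
  Literature.NumberTheory.EllipticCurves.Rank1Residual
  Literature.NumberTheory.EllipticCurves.TianYuanZhang2017
open Summit.BirchSwinnertonDyer Summit.BirchSwinnertonDyer.Rank1Residual.WAll

set_option autoImplicit false

namespace Summit.BirchSwinnertonDyer.PrintCf2

/-! ## §1 The FJ atlas and the maximal flag-free slice, bundle 𝔅_ram verbatim -/

/-- **The `ω = 3` FJ atlas slice of crux 20362, INSIDE the bundle**: 𝔅_ram ⟹ `BSD(E,2)` for every globally minimal
CM curve of analytic rank one with `2` ramified that is a `ℚ`-model of `E_{p₀p₁p₂}`, three distinct primes with product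
`≡ 7 (8)`, Monsky kernel `2` and Faulkner–James kernel `4` (`CongruentTYZAtlasFJFamily`) — via
`PrintCf2.wAllCornerFTwoRamifiedTYZAtlasFJ_of_facts` (facts used: TYZ Thm 1.2′ = conjunct 5, GZK = conjunct 1).
Beyond print: YES. [cite: TianYuanZhang2017, Thm. 1.2 (as printed)] [cite: FaulknerJames2007, Thm. 1.2 (2)] [cite: Miller2011LMS, Def. 1.1] -/
theorem stub_ramified_onTYZAtlasFJ : (Literature.NumberTheory.EllipticCurves.rank_eq_analyticRank_of_analyticRank_le_one ∧ WeierstrassCurve.hasEntireLFunction_rat ∧ WeierstrassCurve.bsdRHS_eq_of_isIsogenous ∧ Literature.NumberTheory.EllipticCurves.bsdTriple_of_hasCM_of_L_one_ne_zero ∧ Literature.NumberTheory.EllipticCurves.TianYuanZhang2017.thm12_parity_of_scriptL' ∧ Literature.NumberTheory.EllipticCurves.Tian2014.thm13_rank_one_and_sha_odd ∧ Literature.NumberTheory.QuadraticFields.RedeiReichardt.redeiReichardt_fourTwoCard_classGroup ∧ Literature.NumberTheory.EllipticCurves.LiLiuTian2024.thm12_bsd_congruentNumberCurve ∧ Literature.NumberTheory.EllipticCurves.Monsky1990.cor515_rank_eq_one_and_card_selmerGroup_two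 ∧ Literature.NumberTheory.EllipticCurves.HeathBrown1994.monsky_card_selmerGroup_two_even ∧ Literature.NumberTheory.EllipticCurves.Tian2014.tian2014_system_sMinus_genus) → ∀ (W : WeierstrassCurve ℚ) [W.IsElliptic] [W.IsGloballyMinimal], W.HasCM → W.analyticRank = 1 → Literature.NumberTheory.EllipticCurves.Rank1Residual.CMRamified W 2 → Summit.BirchSwinnertonDyer.CongruentTYZAtlasFJFamily W → Literature.NumberTheory.EllipticCurves.BSDp W 2 :=
  fun hB ↦ Rank1Residual.WAll.PrintCf2.wAllCornerFTwoRamifiedTYZAtlasFJ_of_facts hB.2.2.2.2.1 hB.1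

/-- **THE MAXIMAL FLAG-FREE p1 SLICE of crux 20362**: 𝔅_ram ⟹ `BSD(E,2)` on every ramified rank-one CM curve that is
a model of a member of `CongruentTYZProvedFamily` (LLT ∨ T5 ∨ T7 ∨ M35 ∨ TYZρ) OR of `CongruentTYZAtlasFJFamily`.
[cite: TianYuanZhang2017, Thm. 1.2] [cite: Tian2014, Thm. 1.3] [cite: LiLiuTian2024, Thm. 1.2] [cite: Miller2011LMS, Def. 1.1] -/
theorem stub_ramified_onTYZFlagFree : (Literature.NumberTheory.EllipticCurves.rank_eq_analyticRank_of_analyticRank_le_one ∧ WeierstrassCurve.hasEntireLFunction_rat ∧ WeierstrassCurve.bsdRHS_eq_of_isIsogenous ∧ Literature.NumberTheory.EllipticCurves.bsdTriple_of_hasCM_of_L_one_ne_zero ∧ Literature.NumberTheory.EllipticCurves.TianYuanZhang2017.thm12_parity_of_scriptL' ∧ Literature.NumberTheory.EllipticCurves.Tian2014.thm13_rank_one_and_sha_odd ∧ Literature.NumberTheory.QuadraticFields.RedeiReichardt.redeiReichardt_fourTwoCard_classGroup ∧ Literature.NumberTheory.EllipticCurves.LiLiuTian2024.thm12_bsd_congruentNumberCurve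 ∧ Literature.NumberTheory.EllipticCurves.Monsky1990.cor515_rank_eq_one_and_card_selmerGroup_two ∧ Literature.NumberTheory.EllipticCurves.HeathBrown1994.monsky_card_selmerGroup_two_even ∧ Literature.NumberTheory.EllipticCurves.Tian2014.tian2014_system_sMinus_genus) → ∀ (W : WeierstrassCurve ℚ) [W.IsElliptic] [W.IsGloballyMinimal], W.HasCM → W.analyticRank = 1 → Literature.NumberTheory.EllipticCurves.Rank1Residual.CMRamified W 2 → (Summit.BirchSwinnertonDyer.CongruentTYZProvedFamily W ∨ Summit.BirchSwinnertonDyer.CongruentTYZAtlasFJFamily W) → Literature.NumberTheory.EllipticCurves.BSDp W 2 := by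
  intro hB W _ _ hcm hr hram hmem
  rcases hmem with hP | hF
  · exact stub_ramified_onTYZProvedFamilies hB W hcm hr hram hP
  · exact stub_ramified_onTYZAtlasFJ hB W hcm hr hram hF

/-! ## §2 The U⁺ road: exactly one fact outside the bundle (`tyz_genusPointData`, A312) -/

/-- **𝔅_ram ∧ TYZ §3 displayed ⟹ the U⁺-road leaf** `WAllCornerFTwoRamifiedTYZUPlus` (T6 ∨ TYZ-U⁺ ∨ A37): the
`…OfFactsPlus`-shaped closer (facts used: A312, GZK, Tian14 Thm 1.3). LITERAL-by-name (A312). Beyond print: YES.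
[cite: TianYuanZhang2017, Prop. 3.4, Thm. 3.5] [cite: Tian2014, Thm. 1.3 and Thm. 5.2] [cite: Miller2011LMS, Def. 1.1] -/
theorem wAllCornerFTwoRamifiedTYZUPlus_of_bundle_of_genusPointData
    (hB : (Literature.NumberTheory.EllipticCurves.rank_eq_analyticRank_of_analyticRank_le_one ∧ WeierstrassCurve.hasEntireLFunction_rat ∧ WeierstrassCurve.bsdRHS_eq_of_isIsogenous ∧ Literature.NumberTheory.EllipticCurves.bsdTriple_of_hasCM_of_L_one_ne_zero ∧ Literature.NumberTheory.EllipticCurves.TianYuanZhang2017.thm12_parity_of_scriptL' ∧ Literature.NumberTheory.EllipticCurves.Tian2014.thm13_rank_one_and_sha_odd ∧ Literature.NumberTheory.QuadraticFields.RedeiReichardt.redeiReichardt_fourTwoCard_classGroup ∧ Literature.NumberTheory.EllipticCurves.LiLiuTian2024.thm12_bsd_congruentNumberCurve ∧ Literature.NumberTheory.EllipticCurves.Monsky1990.cor515_rank_eq_one_and_card_selmerGroup_two ∧ Literature.NumberTheory.EllipticCurves.HeathBrown1994.monsky_card_selmerGroup_two_even ∧ Literature.NumberTheory.EllipticCurv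es.Tian2014.tian2014_system_sMinus_genus))
    (hTYZ : Literature.NumberTheory.EllipticCurves.TianYuanZhang2017.tyz_genusPointData) :
    WAllCornerFTwoRamifiedTYZUPlus :=
  Rank1Residual.WAll.PrintCf2.wAllCornerFTwoRamifiedTYZUPlus_of_facts hTYZ hB.1 hB.2.2.2.2.2.1

/-- **𝔅_ram ∧ A312 ⟹ (crux 20362 ⟸ the FOUR-WAY residual)**: granted the bundle and the TYZ §3 display, the whole
ramified slice follows from `WAllCornerFTwoRamifiedOffTYZ` (ramified, rank one, CM, off ALL p1 families) — i.e. with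
the Plus fact the residual of 20362 shrinks from `…OffTYZProved` to `…OffTYZ`. [folklore] -/
theorem ramifiedTwoRankOne_of_bundle_of_genusPointData_of_offTYZ
    (hB : (Literature.NumberTheory.EllipticCurves.rank_eq_analyticRank_of_analyticRank_le_one ∧ WeierstrassCurve.hasEntireLFunction_rat ∧ WeierstrassCurve.bsdRHS_eq_of_isIsogenous ∧ Literature.NumberTheory.EllipticCurves.bsdTriple_of_hasCM_of_L_one_ne_zero ∧ Literature.NumberTheory.EllipticCurves.TianYuanZhang2017.thm12_parity_of_scriptL' ∧ Literature.NumberTheory.EllipticCurves.Tian2014.thm13_rank_one_and_sha_odd ∧ Literature.NumberTheory.QuadraticFields.RedeiReichardt.redeiReichardt_fourTwoCard_classGroup ∧ Literature.NumberTheory.EllipticCurves.LiLiuTian2024.thm12_bsd_congruentNumberCurve ∧ Literature.NumberTheory.EllipticCurves.Monsky1990.cor515_rank_eq_one_and_card_selmerGroup_two ∧ Literature.NumberTheory.EllipticCurves.HeathBrown1994.monsky_card_selmerGroup_two_even ∧ Literature.NumberTheory.EllipticCurves.Tian2014.tian2014_system_sMinus_genus))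
    (hTYZ : Literature.NumberTheory.EllipticCurves.TianYuanZhang2017.tyz_genusPointData)
    (hO : WAllCornerFTwoRamifiedOffTYZ) :
    ∀ (W : WeierstrassCurve ℚ) [W.IsElliptic] [W.IsGloballyMinimal], W.HasCM → W.analyticRank = 1 →
      CMRamified W 2 → BSDp W 2 :=
  wAllCornerFTwoRamified_of_tyzProved_of_offTYZProved (wAllCornerFTwoRamifiedTYZProved_of_bundle hB)
    (Rank1Residual.WAll.PrintCf2.wAllCornerFTwoRamifiedOffTYZProved_of_facts_of_offTYZ hTYZ hB.1 hB.2.2.2.2.2.1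
      hB.2.2.2.2.1 hO)

end Summit.BirchSwinnertonDyer.PrintCf2

end
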